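import Mathlib
import Summits.MatrixMultiplication.MatrixMultiplication.Theorems.GradedDesignFamily.Negative.EquivariantCount

/-!
# Relative (weighted) evaluation count for one-subgroup identity tests

Support file for the crux `LevelGradedCohnUmans.GradedDesignFamily`
(item `stmt-MatrixMultiplication-7610`), skeleton line `quadratic_extension_level_one_cell`,
stub `stub_subfieldCell` (S3).  HONEST FRAMING: a counting lemma used to DECIDE toy cells
(`q = 4, 5`) of S3 by theorem; it is not summit progress.

Setting: `φ : H →* G` injective, `J ≤ ℂ^G` right-translation invariant, `Y, Z ⊆ G` nonempty and
separated against `X = φ(H)` exactly as in the graded Neumann count (`packing_X`).  For ANY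
weight `e : H → ℂ` put `T_e f (g) = ∑_t e(t) f(φ(t) g)` on `ℂ^G` and `R_e u (h) = ∑_t e(t) u(t h)`
on `ℂ^H`.  Then `(|Y| + |Z| - 1) · rank R_e ≤ dim span (T_e J)` (`relativeCount_le`).

Proof: evaluation at the points `φ(h) z` (`z ∈ Z`) and `φ(h) y y₁⁻¹ z₁` (`y ∈ Y ∖ y₁`) maps `J`
ONTO `ℂ^{H × I}`, `|I| = |Z| + |Y| - 1` (block-triangular surjectivity
`map_eq_top_of_triangular`), and intertwines `T_e` with `R_e ⊗ 1_I`, whose range contains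
`(range R_e)^I`, of dimension `|I| · rank R_e`.  With `e = (σ(1)/|H|)·σ` this is the isotypic
count `equivariantCount_le`; the point of the general form is that a CUSP FORM `e` (a weight whose
`T_e` kills most of a permutation module) is certified by a finite check on `e`, with no
irreducible character to construct.  [cite: Neumann2011, Observation 3.1]
-/

set_option linter.dupNamespace false

noncomputable section

open scoped BigOperators
open Module

namespace Summit.MatrixMultiplication.MatrixMultiplication.Theorems.GradedDesignFamily.Negative

/-- **Relative evaluation count.**  For an injective hom `φ : H →* G`, a right-invariant
`J ≤ ℂ^G`, nonempty `Y, Z` separated against `φ(H)` (graded Neumann separation), and any weight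
`e : H → ℂ`:  `(|Y| + |Z| - 1) · rank R_e ≤ dim span (T_e J)`, where
`R_e = ∑_t e(t) • (u ↦ u(t ·))` on `ℂ^H` and `T_e f = (g ↦ ∑_t e(t) f(φ(t) g))`.
[cite: Neumann2011, Observation 3.1] -/
theorem relativeCount_le {G H : Type} [Group G] [Fintype G] [DecidableEq G] [Group H] [Fintype H]
    [DecidableEq H] (φ : H →* G) (hφ : Function.Injective φ)
    (J : Submodule ℂ (G → ℂ)) (hr : ∀ f ∈ J, ∀ b : G, (fun g => f (g * b)) ∈ J)
    (Y Z : Finset G) (hY : Y.Nonempty) (hZ : Z.Nonempty)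
    (hsep : ∀ x₀ ∈ Finset.univ.image φ, ∀ z₀ ∈ Z, ∃ f ∈ J, ∀ x ∈ Finset.univ.image φ,
      ∀ y ∈ Y, ∀ y' ∈ Y, ∀ z ∈ Z,
        (x = x₀ ∧ y = y' ∧ z = z₀ → f (x⁻¹ * y * y'⁻¹ * z) = 1) ∧
        (¬ (x = x₀ ∧ y = y' ∧ z = z₀) → f (x⁻¹ * y * y'⁻¹ * z) = 0))
    (e : H → ℂ) :
    (Y.card + Z.card - 1) *
        finrank ℂ (LinearMap.range (∑ t : H, e t • LinearMap.funLeft ℂ ℂ fun h : H => t * h)) ≤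
      finrank ℂ (Submodule.span ℂ
        ((fun f : G → ℂ => fun g : G => ∑ t : H, e t * f (φ t * g)) '' (J : Set (G → ℂ)))) := by
  classical
  obtain ⟨y₁, hy₁⟩ := hY
  obtain ⟨z₁, hz₁⟩ := hZ
  -- the operators `R_e` (on `ℂ^H`), `T_e` (on `ℂ^G`)
  set R : (H → ℂ) →ₗ[ℂ] (H → ℂ) := ∑ t : H, e t • LinearMap.funLeft ℂ ℂ fun h : H => t * h
    with hR_def
  have hR : ∀ (u : H → ℂ) (h : H), R u h = ∑ t : H, e t * u (t * h) := by
    intro u h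
    simp only [hR_def, LinearMap.coe_sum, Finset.sum_apply, LinearMap.smul_apply,
      LinearMap.funLeft_apply, Pi.smul_apply, smul_eq_mul]
  let T : (G → ℂ) →ₗ[ℂ] (G → ℂ) := ∑ t : H, e t • LinearMap.funLeft ℂ ℂ fun g : G => φ t * g
  have hT : ∀ f : G → ℂ, T f = fun g => ∑ t : H, e t * f (φ t * g) := by
    intro f
    funext g
    simp only [T, LinearMap.coe_sum, Finset.sum_apply, LinearMap.smul_apply,
      LinearMap.funLeft_apply, Pi.smul_apply, smul_eq_mul]
  -- the `|Z| + (|Y| - 1)` families of points `φ(h) z`, `φ(h) y y₁⁻¹ z₁`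
  let pt : ↥Z ⊕ ↥(Y.erase y₁) → G :=
    Sum.elim (fun z : ↥Z => (z : G)) (fun y : ↥(Y.erase y₁) => (y : G) * y₁⁻¹ * z₁)
  let π : H × (↥Z ⊕ ↥(Y.erase y₁)) → G := fun p => φ p.1 * pt p.2
  let ev : (G → ℂ) →ₗ[ℂ] (H × (↥Z ⊕ ↥(Y.erase y₁)) → ℂ) := LinearMap.funLeft ℂ ℂ π
  -- `S = R_e ⊗ 1_I` on `ℂ^{H × I}`
  let S : (H × (↥Z ⊕ ↥(Y.erase y₁)) → ℂ) →ₗ[ℂ] (H × (↥Z ⊕ ↥(Y.erase y₁)) → ℂ) :=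
    ∑ t : H, e t • LinearMap.funLeft ℂ ℂ fun p : H × (↥Z ⊕ ↥(Y.erase y₁)) => (t * p.1, p.2)
  have hS : ∀ (u : H × (↥Z ⊕ ↥(Y.erase y₁)) → ℂ) (p : H × (↥Z ⊕ ↥(Y.erase y₁))),
      S u p = ∑ t : H, e t * u (t * p.1, p.2) := by
    intro u p
    simp only [S, LinearMap.coe_sum, Finset.sum_apply, LinearMap.smul_apply,
      LinearMap.funLeft_apply, Pi.smul_apply, smul_eq_mul]
  have hmemX : ∀ h : H, (φ h)⁻¹ ∈ Finset.univ.image φ := fun h =>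
    Finset.mem_image.2 ⟨h⁻¹, Finset.mem_univ _, map_inv φ h⟩
  -- (1) evaluation at the points is onto `ℂ^{H × I}`
  have htop : J.map ev = ⊤ := by
    refine map_eq_top_of_triangular J ev (fun p => ∃ z, p.2 = Sum.inl z) ?_ ?_
    · rintro ⟨h₀, i₀⟩ ⟨z₀, hi₀⟩
      dsimp only at hi₀
      subst hi₀
      obtain ⟨f, hf, hspec⟩ := hsep (φ h₀)⁻¹ (hmemX h₀) z₀ z₀.2
      refine ⟨f, hf, ?_⟩
      rintro ⟨h, z | y⟩
      · -- target point `φ(h) z`: the separator of `((φ h₀)⁻¹, z₀)` reads `[h = h₀ ∧ z = z₀]`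
        have h1 := hspec (φ h)⁻¹ (hmemX h) y₁ hy₁ y₁ hy₁ z z.2
        rw [inv_inv, mul_inv_cancel_right] at h1
        simp only [ev, LinearMap.funLeft_apply, π, pt, Sum.elim_inl, Prod.mk.injEq, Sum.inl.injEq]
        by_cases hc : h₀ = h ∧ z₀ = z
        · rw [if_pos hc]
          exact h1.1 ⟨by rw [hc.1], rfl, by rw [hc.2]⟩
        · rw [if_neg hc]
          refine h1.2 ?_
          rintro ⟨hh, -, hz⟩
          exact hc ⟨(hφ (inv_inj.1 hh)).symm, (Subtype.ext hz).symm⟩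
      · -- slab point `φ(h) y y₁⁻¹ z₁` with `y ≠ y₁`: the separator vanishes
        have hy := Finset.mem_erase.1 y.2
        have h1 := hspec (φ h)⁻¹ (hmemX h) y hy.2 y₁ hy₁ z₁ hz₁
        have e1 : ((φ h)⁻¹)⁻¹ * (y : G) * y₁⁻¹ * z₁ = φ h * ((y : G) * y₁⁻¹ * z₁) := by
          simp only [inv_inv, mul_assoc]
        rw [e1] at h1
        rw [if_neg (by simp)]
        simp only [ev, LinearMap.funLeft_apply, π, pt, Sum.elim_inr]
        refine h1.2 ?_
        rintro ⟨-, hyy, -⟩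
        exact hy.1 hyy
    · rintro ⟨h₀, i₀⟩ hi₀
      obtain ⟨y₀, rfl⟩ : ∃ y₀, i₀ = Sum.inr y₀ := by
        cases i₀ with
        | inl z => exact absurd ⟨z, rfl⟩ hi₀
        | inr y => exact ⟨y, rfl⟩
      have hy₀ := Finset.mem_erase.1 y₀.2
      -- the right translate by `z₁⁻¹ y₁ y₀⁻¹ z₁` of the separator of `((φ h₀)⁻¹, z₁)`
      obtain ⟨f, hf, hspec⟩ := hsep (φ h₀)⁻¹ (hmemX h₀) z₁ hz₁
      refine ⟨fun g => f (g * (z₁⁻¹ * y₁ * (y₀ : G)⁻¹ * z₁)), hr f hf _, ?_⟩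
      rintro ⟨h, z | y⟩ hj
      · exact absurd ⟨z, rfl⟩ hj
      · have hy := Finset.mem_erase.1 y.2
        have h1 := hspec (φ h)⁻¹ (hmemX h) y hy.2 y₀ hy₀.2 z₁ hz₁
        have e1 : φ h * ((y : G) * y₁⁻¹ * z₁) * (z₁⁻¹ * y₁ * (y₀ : G)⁻¹ * z₁) =
            ((φ h)⁻¹)⁻¹ * y * (y₀ : G)⁻¹ * z₁ := by
          group
        simp only [ev, LinearMap.funLeft_apply, π, pt, Sum.elim_inr, Prod.mk.injEq, Sum.inr.injEq]
        rw [e1]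
        by_cases hc : h₀ = h ∧ y₀ = y
        · rw [if_pos hc]
          exact h1.1 ⟨by rw [hc.1], by rw [hc.2], rfl⟩
        · rw [if_neg hc]
          refine h1.2 ?_
          rintro ⟨hh, hyy, -⟩
          exact hc ⟨(hφ (inv_inj.1 hh)).symm, (Subtype.ext hyy).symm⟩
  -- (2) evaluation intertwines `T_e` with `S`
  have hinter : ev ∘ₗ T = S ∘ₗ ev := by
    refine LinearMap.ext fun f => funext fun p => ?_
    rw [LinearMap.comp_apply, LinearMap.comp_apply, hS]
    simp only [ev, LinearMap.funLeft_apply, hT, π, map_mul, mul_assoc]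
  -- (3) hence `range S = ev (T_e J)`
  have hrangeS : LinearMap.range S = (J.map T).map ev := by
    rw [← Submodule.map_comp, hinter, Submodule.map_comp, htop, Submodule.map_top]
  -- (4) `(range R_e)^I ↪ range S`, coordinatewise
  let Θ : ((↥Z ⊕ ↥(Y.erase y₁)) → ↥(LinearMap.range R)) →ₗ[ℂ]
      (H × (↥Z ⊕ ↥(Y.erase y₁)) → ℂ) :=
    { toFun := fun F p => (F p.2 : H → ℂ) p.1
      map_add' := fun F F' => rfl
      map_smul' := fun c F => rfl }
  have hΘinj : Function.Injective Θ := by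
    intro F F' hFF'
    funext i
    apply Subtype.ext
    funext h
    exact congr_fun hFF' (h, i)
  have hΘS : LinearMap.range Θ ≤ LinearMap.range S := by
    rintro _ ⟨F, rfl⟩
    choose u hu using fun i => LinearMap.mem_range.1 (F i).2
    refine ⟨fun p => u p.2 p.1, funext fun p => ?_⟩
    rw [hS]
    change ∑ t : H, e t * u p.2 (t * p.1) = (F p.2 : H → ℂ) p.1
    rw [← hu p.2, hR]
  -- (5) dimensions
  have hdimΘ : finrank ℂ (LinearMap.range Θ) =
      (Z.card + (Y.card - 1)) * finrank ℂ (LinearMap.range R) := by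
    rw [LinearMap.finrank_range_of_inj hΘinj, Module.finrank_pi_fintype ℂ, Finset.sum_const,
      Finset.card_univ, smul_eq_mul, Fintype.card_sum, Fintype.card_coe, Fintype.card_coe,
      Finset.card_erase_of_mem hy₁]
  have hspan : Submodule.span ℂ
      ((fun f : G → ℂ => fun g : G => ∑ t : H, e t * f (φ t * g)) '' (J : Set (G → ℂ))) =
      J.map T := by
    have hfun : (fun f : G → ℂ => fun g : G => ∑ t : H, e t * f (φ t * g)) = ⇑T :=
      funext fun f => (hT f).symm
    rw [hfun, Submodule.span_image, Submodule.span_eq]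
  have hcard : Y.card + Z.card - 1 = Z.card + (Y.card - 1) := by
    have := Finset.card_pos.2 ⟨y₁, hy₁⟩
    omega
  rw [hspan, hcard, ← hdimΘ]
  calc finrank ℂ (LinearMap.range Θ) ≤ finrank ℂ (LinearMap.range S) :=
        Submodule.finrank_mono hΘS
    _ = finrank ℂ ((J.map T).map ev) := by rw [hrangeS]
    _ ≤ finrank ℂ (J.map T) := Submodule.finrank_map_le _ _

end Summit.MatrixMultiplication.MatrixMultiplication.Theorems.GradedDesignFamily.Negative

end
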